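import Mathlib
import Summits.HubbardSuperconductivity.HubbardSuperconductivity.Theorems.LevyLogBootstrapBlock2InfDivXXZFourCheckA

/-!
# Crux `Block2InfDivXXZ` (stmt-HubbardSuperconductivity-15048), `M = 4` slice: the kernel checks,
# part B (cells)

Computable definitions only: rational list arithmetic on class vectors of length `74` (`dotNQ`,
`wipL`, `mulCL`, `mulC1L`, `mulTL`, `axpyL`), the cell record `CellData` with its polynomial
coefficient lists, the range bounds `polyHi`/`polyLo`, the integer Gram certificate (`gramRat`,
`gramInt`, `cholRows`, `gramRes`, `ddRow`, `gramRows`) and the cell checks `shapeCheck`,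
`scalarCheck`, `obsCheck`, `cornerCheck`. Soundness in the `…Four{Gram,CellPoly,Cell}` files.
-/

set_option linter.dupNamespace false

namespace Summit.HubbardSuperconductivity.HubbardSuperconductivity.Theorems.LevyLogBootstrap

noncomputable section

namespace FourCert

open Finset
/-! ### Rational list arithmetic (vectors of length `74`) -/

/-- Dot product `Σ_b m_b z_b` of a row of naturals with a rational vector. -/
def dotNQ (row : List ℕ) (z : List ℚ) : ℚ := (List.zipWith (fun (m : ℕ) (x : ℚ) => (m : ℚ) * x) row z).sum

/-- Weighted inner product `Σ_a n_a u_a v_a` on lists. -/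
def wipL (u v : List ℚ) : ℚ :=
  (List.zipWith3 (fun (m : ℕ) (x y : ℚ) => (m : ℚ) * (x * y)) orbitSize u v).sum

/-- `C(Δ) z = -Δ diag ⊙ z - (hop z)/2` on lists. -/
def mulCL (Δ : ℚ) (z : List ℚ) : List ℚ :=
  List.zipWith3 (fun (dg : ℤ) (row : List ℕ) (x : ℚ) => -Δ * ((dg : ℚ) / 4) * x - dotNQ row z / 2) diag4 hopTab z

/-- `C¹ z = -diag ⊙ z` on lists. -/
def mulC1L (z : List ℚ) : List ℚ := List.zipWith (fun (dg : ℤ) (x : ℚ) => -((dg : ℚ) / 4) * x) diag4 z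

/-- `T_h z` on lists. -/
def mulTL (hh : ℕ) (z : List ℚ) : List ℚ := (tTab hh).map fun row => dotNQ row z

/-- Pointwise linear combination `u + c v`. -/
def axpyL (c : ℚ) (u v : List ℚ) : List ℚ := List.zipWith (fun x y => x + c * y) u v

/-! ### Cells -/

/-- Data of one `Δ`-cell: centre `c`, half-width `h`, gap threshold `θ` and margin parameter `μ` of
the Gram certificate, the linear trial ground vector `ŷ(Δ) = (y0 + (Δ-c) y1)/2^24`, the linear
energy surrogate `ρ(Δ) = (ρ0 + (Δ-c) ρ1)/2^24`, square-root surrogates `rbar, tbar h`, and the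
claimed enclosures `klo h ≤ κ_h ≤ khi h` (`h = 1..4`, lists indexed from `0`). -/
structure CellData where
  /-- centre -/
  c : ℚ
  /-- half-width -/
  h : ℚ
  /-- gap threshold (scaled by `2^24`) -/
  θ : ℤ
  /-- Gram margin -/
  μ : ℕ
  /-- trial vector at the centre (scaled by `2^24`) -/
  y0 : List ℤ
  /-- its `Δ`-derivative (scaled by `2^24`) -/
  y1 : List ℤ
  /-- energy surrogate at the centre (scaled by `2^24`) -/
  ρ0 : ℤ
  /-- its slope (scaled by `2^24`) -/
  ρ1 : ℤ
  /-- claimed lower bound of `⟪ŷ,ŷ⟫ₙ` on the cell -/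
  qlo : ℚ
  /-- claimed upper bound of `⟪ŷ,ŷ⟫ₙ` on the cell -/
  qhi : ℚ
  /-- claimed gap margin `g ≤ θ' - ē` -/
  g : ℚ
  /-- upper surrogate of the residual norm -/
  rbar : ℚ
  /-- upper surrogates of `‖T_h ŷ‖` -/
  tbar : List ℚ
  /-- claimed lower bounds of `κ_h` -/
  klo : List ℚ
  /-- claimed upper bounds of `κ_h` -/
  khi : List ℚ

namespace CellData

variable (d : CellData)

/-- `ŷ₀` as a rational list. -/
def y0L : List ℚ := d.y0.map fun z : ℤ => (z : ℚ) / 2 ^ 24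
/-- `ŷ₁` as a rational list. -/
def y1L : List ℚ := d.y1.map fun z : ℤ => (z : ℚ) / 2 ^ 24
/-- `θ`. -/
def θQ : ℚ := (d.θ : ℚ) / 2 ^ 24
/-- `ρ₀`. -/
def ρ0Q : ℚ := (d.ρ0 : ℚ) / 2 ^ 24
/-- `ρ₁`. -/
def ρ1Q : ℚ := (d.ρ1 : ℚ) / 2 ^ 24

/-- Coefficients of `q(δ) = ⟪ŷ,ŷ⟫ₙ`. -/
def qCoef : List ℚ := [wipL d.y0L d.y0L, 2 * wipL d.y0L d.y1L, wipL d.y1L d.y1L]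

/-- `C(c) ŷ₀`. -/
def cy0 : List ℚ := mulCL d.c d.y0L
/-- `C(c) ŷ₁`. -/
def cy1 : List ℚ := mulCL d.c d.y1L
/-- `C¹ ŷ₀`. -/
def c1y0 : List ℚ := mulC1L d.y0L
/-- `C¹ ŷ₁`. -/
def c1y1 : List ℚ := mulC1L d.y1L

/-- Coefficients of `e(δ) = ⟪ŷ, C(c+δ) ŷ⟫ₙ` (cubic). -/
def eCoef : List ℚ :=
  [wipL d.y0L d.cy0,
   wipL d.y0L d.cy1 + wipL d.y1L d.cy0 + wipL d.y0L d.c1y0,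
   wipL d.y1L d.cy1 + wipL d.y0L d.c1y1 + wipL d.y1L d.c1y0,
   wipL d.y1L d.c1y1]

/-- Residual coefficients `R(δ) = (C(c+δ) - ρ(δ)) ŷ(δ) = R₀ + δ R₁ + δ² R₂`: `R₀ = C(c)ŷ₀ - ρ₀ŷ₀`. -/
def r0 : List ℚ := axpyL (-d.ρ0Q) d.cy0 d.y0L
/-- `R₁ = C(c)ŷ₁ + C¹ŷ₀ - ρ₀ŷ₁ - ρ₁ŷ₀`. -/
def r1 : List ℚ := axpyL (-d.ρ1Q) (axpyL (-d.ρ0Q) (axpyL 1 d.cy1 d.c1y0) d.y1L) d.y0L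
/-- `R₂ = C¹ŷ₁ - ρ₁ŷ₁`. -/
def r2 : List ℚ := axpyL (-d.ρ1Q) d.c1y1 d.y1L

/-- Coefficients of `‖R(δ)‖ₙ²` (quartic). -/
def resCoef : List ℚ :=
  [wipL d.r0 d.r0, 2 * wipL d.r0 d.r1, 2 * wipL d.r0 d.r2 + wipL d.r1 d.r1, 2 * wipL d.r1 d.r2,
    wipL d.r2 d.r2]

/-- `T_h ŷ₀`. -/
def ty0 (hh : ℕ) : List ℚ := mulTL hh d.y0L
/-- `T_h ŷ₁`. -/
def ty1 (hh : ℕ) : List ℚ := mulTL hh d.y1L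
/-- Coefficients of `k_h(δ) = ⟪ŷ, T_h ŷ⟫ₙ` (quadratic). -/
def kCoef (hh : ℕ) : List ℚ :=
  [wipL d.y0L (d.ty0 hh), wipL d.y0L (d.ty1 hh) + wipL d.y1L (d.ty0 hh), wipL d.y1L (d.ty1 hh)]
/-- Coefficients of `‖T_h ŷ(δ)‖ₙ²` (quadratic). -/
def tCoef (hh : ℕ) : List ℚ :=
  [wipL (d.ty0 hh) (d.ty0 hh), 2 * wipL (d.ty0 hh) (d.ty1 hh), wipL (d.ty1 hh) (d.ty1 hh)]

end CellData

/-- Upper bound of `Σ_k c_k δ^k` on `|δ| ≤ h`: `c₀ + Σ_{k ≥ 1} |c_k| h^k`. -/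
def polyHi (cs : List ℚ) (h : ℚ) : ℚ := cs.getD 0 0 + ((cs.drop 1).zipIdx.map fun p => |p.1| * h ^ (p.2 + 1)).sum
/-- Lower bound of `Σ_k c_k δ^k` on `|δ| ≤ h`: `c₀ - Σ_{k ≥ 1} |c_k| h^k`. -/
def polyLo (cs : List ℚ) (h : ℚ) : ℚ := cs.getD 0 0 - ((cs.drop 1).zipIdx.map fun p => |p.1| * h ^ (p.2 + 1)).sum

/-- Number of ordered site pairs at Gray distance `h`: `16 · C(4,h)`. -/
def pairs (hh : ℕ) : ℚ := 16 * (Nat.choose 4 hh : ℚ)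

/-! ### The integer Gram certificate -/

/-- Rational matrix of the cell's gap form at the centre, scaled by `2^56`:
`2^56 · (n_a C(c)_ab - θ [a=b] n_a + 8 · (n_a ŷ₀_a)(n_b ŷ₀_b))`, rows as lists. -/
def gramRat (d : CellData) : List (List ℚ) :=
  (List.zipWith3 (fun (p : ℕ × ℕ) (dg : ℤ) (q : List ℕ × ℚ) =>
      -- p = (a, n_a), dg = diag4_a, q = (hop row a, ŷ₀_a)
      (List.zipWith3 (fun (pb : ℕ × ℕ) (hb : ℕ) (yb : ℚ) =>
          2 ^ 56 * ((p.2 : ℚ) * ((if p.1 = pb.1 then -d.c * ((dg : ℚ) / 4) - d.θQ else 0) - (hb : ℚ) / 2) +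
            8 * ((p.2 : ℚ) * q.2) * ((pb.2 : ℚ) * yb)))
        (List.range 74 |>.zip orbitSize) q.1 d.y0L))
    (List.range 74 |>.zip orbitSize) diag4 (hopTab.zip d.y0L))

/-- Are all scaled entries integral? -/
def gramIntegral (d : CellData) : Bool := (gramRat d).all fun row => row.all fun x => x.den = 1

/-- The conditioned integer matrix `D (2^56 B) D`, `D_a = ⌊√(2^20/n_a)⌋`. -/
def gramInt (d : CellData) : List (List ℤ) :=
  List.zipWith (fun (na : ℕ) (row : List ℚ) =>
      List.zipWith (fun (nb : ℕ) (x : ℚ) =>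
        (Nat.sqrt (2 ^ 20 / na) : ℤ) * x.num * (Nat.sqrt (2 ^ 20 / nb) : ℤ)) orbitSize row)
    orbitSize (gramRat d)

/-- Integer dot product of two lists. -/
def dotZ (u v : List ℤ) : ℤ := (List.zipWith (· * ·) u v).sum

/-- Untrusted integer Cholesky rows of `s·B - M·I` (`G` lower triangular, `G Gᵀ ≈ s·B - M·I`);
row `i` uses rows `< i`. Returns the rows in order. -/
def cholRows (B : List (List ℤ)) (s M : ℤ) : List (List ℤ) :=
  (B.zipIdx.foldl (fun (rows : List (List ℤ)) (p : List ℤ × ℕ) =>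
    let bi := p.1
    let i := p.2
    -- off-diagonal entries j < i
    let rowi : List ℤ := (rows.zipIdx.foldl (fun (acc : List ℤ) (q : List ℤ × ℕ) =>
        let gj := q.1
        let j := q.2
        let gjj := gj.getD j 1
        let v := (s * bi.getD j 0 - dotZ acc gj) / (if gjj = 0 then 1 else gjj)
        acc ++ [v]) [])
    let dii := s * bi.getD i 0 - M - dotZ rowi rowi
    rows ++ [rowi ++ [Int.sqrt dii]]) [])

/-- The Gram residual `R = s·B - G Gᵀ`, entry `(a, b)` (lists read with `getD`). -/
def gramRes (B G : List (List ℤ)) (s : ℤ) (a b : ℕ) : ℤ :=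
  s * (B.getD a []).getD b 0 - dotZ (G.getD a []) (G.getD b [])

/-- Row `a` of the Gram residual is diagonally dominant in the one-sided form
`Σ_{b ≠ a, b < 74} |R_ab| ≤ R_aa` (with `B`, hence `R`, symmetric this gives `R ⪰ 0`). -/
def ddRow (B G : List (List ℤ)) (s : ℤ) (a : ℕ) : Bool :=
  let ba := B.getD a []
  let ga := G.getD a []
  decide ((((List.range 74).map fun b => if b = a then 0 else |s * ba.getD b 0 - dotZ ga (G.getD b [])|).sum) ≤
    s * ba.getD a 0 - dotZ ga ga)

/-- Rows `lo ≤ a < hi` of the Gram residual are diagonally dominant. -/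
def ddRowsOk (B G : List (List ℤ)) (s : ℤ) (lo hi : ℕ) : Bool :=
  (List.range' lo (hi - lo)).all fun a => ddRow B G s a

/-- Is the integer Gram matrix symmetric? -/
def gramSymm (d : CellData) : Bool :=
  let B := gramInt d
  (List.range 74).all fun a => (List.range 74).all fun b => (B.getD a []).getD b 0 = (B.getD b []).getD a 0

/-- The Gram certificate of a cell, rows `lo ≤ a < hi`: diagonal dominance of the residual of the
in-kernel Cholesky factor at scale `2^20` with margin `μ`. -/
def gramRows (d : CellData) (lo hi : ℕ) : Bool :=
  ddRowsOk (gramInt d) (cholRows (gramInt d) (2 ^ 20) d.μ) (2 ^ 20) lo hi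

/-- Shape of the cell data: the vectors have length `74`, the observable lists length `4`. -/
def shapeCheck (d : CellData) : Bool :=
  decide (d.y0.length = 74) && decide (d.y1.length = 74) && decide (d.tbar.length = 4) &&
    decide (d.klo.length = 4) && decide (d.khi.length = 4)

/-! ### The cell check -/

/-- The scalar quantities of a cell: `qlo, qhi` (range of `⟪ŷ,ŷ⟫ₙ`), the gap margin
`g = θ' - ē` with `θ' = θ - 8 h² ‖ŷ₁‖ₙ² - 8 h` and `ē` an upper bound of the Rayleigh quotient,
and `r2` (upper bound of the squared residual norm). -/
def cellScalars (d : CellData) : ℚ × ℚ × ℚ × ℚ :=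
  let qlo := polyLo d.qCoef d.h
  let qhi := polyHi d.qCoef d.h
  let ehi := polyHi d.eCoef d.h
  let ebar := if 0 ≤ ehi then ehi / qlo else ehi / qhi
  let θ' := d.θQ - 8 * d.h ^ 2 * wipL d.y1L d.y1L - 8 * d.h
  (qlo, qhi, θ' - ebar, polyHi d.resCoef d.h)

/-- Scalar inequalities of a cell: the computed `(qlo', qhi', g', r2')` dominate the claimed
`qlo ≤ qlo'`, `qhi' ≤ qhi`, `g ≤ g'`, `r2' ≤ rbar²`, and `0 < qlo`, `0 < g`, `0 ≤ rbar`. -/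
def scalarCheck (d : CellData) : Bool :=
  let sc := cellScalars d
  decide (d.qlo ≤ sc.1) && decide (sc.2.1 ≤ d.qhi) && decide (d.g ≤ sc.2.2.1) &&
    decide (sc.2.2.2 ≤ d.rbar ^ 2) && decide (0 < d.qlo) && decide (0 < d.g) && decide (0 ≤ d.rbar)

/-- Observable block `i` (`h = i + 1`) of a cell: the enclosure `klo ≤ κ_h ≤ khi` in the
square-root-free form of `wexpect_bounds`, with the claimed scalars. -/
def obsCheck (d : CellData) (i : ℕ) : Bool :=
  let hh := i + 1
  let klo := polyLo (d.kCoef hh) d.h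
  let khi := polyHi (d.kCoef hh) d.h
  let t2 := polyHi (d.tCoef hh) d.h
  let tb := d.tbar.getD i 0
  let P := pairs hh
  let lower := klo / d.qhi - d.rbar ^ 2 / (d.qlo * d.g ^ 2) * (khi / d.qlo + P) -
    2 * d.rbar * tb / (d.qlo * d.g)
  let upper := khi / d.qlo + d.rbar ^ 2 / (d.qlo * d.g ^ 2) * P + 2 * d.rbar * tb / (d.qlo * d.g)
  decide (0 ≤ klo) && decide (0 ≤ tb) && decide (t2 ≤ tb ^ 2) &&
  decide (P * d.klo.getD i 0 ≤ lower) && decide (upper ≤ P * d.khi.getD i 0)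

/-- The two `M = 4` Lévy sign conditions from enclosures `klo h ≤ κ_h ≤ khi h`:
with `a₀ = ½ + 2κ₁ + κ₂`, `a₁ = κ₁ + 2κ₂ + κ₃`, `a₂ = κ₂ + 2κ₃ + κ₄` (so that `k₂(0,0) = 4a₀`,
`k₂(1,0) = 4a₁`, `k₂(1,1) = 4a₂`), check `a₁⁺² ≤ a₀⁻ a₂⁻`, `a₂⁺ ≤ a₀⁻`, and positivity. -/
def cornerCheck (klo khi : List ℚ) : Bool :=
  let a0lo := 1 / 2 + 2 * klo.getD 0 0 + klo.getD 1 0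
  let a2lo := klo.getD 1 0 + 2 * klo.getD 2 0 + klo.getD 3 0
  let a1hi := khi.getD 0 0 + 2 * khi.getD 1 0 + khi.getD 2 0
  let a2hi := khi.getD 1 0 + 2 * khi.getD 2 0 + khi.getD 3 0
  decide (0 < a2lo) && decide (0 ≤ klo.getD 0 0) && decide (0 ≤ klo.getD 2 0) &&
  decide (a1hi ^ 2 ≤ a0lo * a2lo) && decide (a2hi ≤ a0lo)

end FourCert

end

end Summit.HubbardSuperconductivity.HubbardSuperconductivity.Theorems.LevyLogBootstrap
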